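import Summits.BirchSwinnertonDyer.BirchSwinnertonDyer.Theorems.GenusKolyvaginAtTwoGenusPrimitiveSupplyAtTwoPosDiscShallowOfKernelsMixed
import HarnessLib

/-!
# SKELETON «genus_supply_pos_shallow» v4 (LEAD gk2-p1 g23, route rev 57: ALL STUBS ARE ROUTE ITEMS) FOR THE SUPPLY CRUX
# `GenusPrimitiveSupplyAtTwoPosDiscShallow` (stmt-BirchSwinnertonDyer-25504, crux rank 2, 0 < Δ)

v3 (LEAD g22, prime-field frame; stubs A⁺‴ / B / C⁺⁗ with C⁺⁗ ⟸ K₁⁺′ ∧ K₄⁺′) RESHAPED onto the rev-54 ITEMISATION: the planner-of-record filed the two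
beyond-print kernels as route items `K1Pos` (stmt-BirchSwinnertonDyer-31468, depth zero, general frame) and `K4Pos` (stmt-BirchSwinnertonDyer-31469,
positive depth, prime frame, real-non-strict Selmer clause) and the glue `GenusPrimitiveSupplyAtTwoPosDiscShallowOfKernels` (stmt-BirchSwinnertonDyer-31470); stub A⁺‴ is DISCHARGED modulo
the items `ModularityExistsNewform` (19382), `TwoParityDD` (23327), `RankOneTwoConverse` (19220), `RankOneTwoConverseOffSemistableAtTwo` (24948)
(`GenusSupplyPos.PrimeFrame.stubA_pos_prime_of_items`), stub B modulo `GrossZagierAllLevels` (24148) (gk2-p4 `GenusKoly.stub_heegnerNonTorsionAtTwo_pair_of_grossZagier`).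
So EVERY stub of this skeleton is a registered route item, stated BY NAME, and the composition is the LEAD g22 glue-by theorem
`GenusSupplyPos.PrimeFrame.genusPrimitiveSupplyAtTwoPosDiscShallow_of_items_of_selmerSplit_mixed` (p766811, sorry-free, standard axioms).
Composition `GenusPrimitiveSupplyAtTwoPosDiscShallow_of` concludes the ROUTE DECL BY NAME; sorries ONLY in the seven `stub_*`.
STATUS OF THE STUBS: five PRINT / declared items (GZ, Mod, Par, Conv, Conv′ — other lines, XL); `stub_K1Pos` LOSSLESS (implied by the leaf modulo
print, `GenusSupplyNarrow.Lossless.K1_pos_of_nonCMAtTwo`; consumed by `closes` rev 57 directly); `stub_K4Pos` = Kolyvagin's conjecture `𝓜_∞ = 0` at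
`p = 2` on the real-narrow `#Sel₂(E) = 4` cell with transposition-deep primes — THE beyond-print content (kernel package: gk2-p5 `…PosDiscShallowKFourPos*`, prime level
`c₁(ℓ) ∈ res_K Sel₂(E/ℚ) ∖ {0}` modulo print).  BSD is NOT proved by this; nothing here is a theorem of the tree until landed.
-/

set_option autoImplicit false
set_option linter.dupNamespace false -- `Summit.<P>.<Sub>` repeats `BirchSwinnertonDyer` (D-0017)

noncomputable section

namespace Summit.BirchSwinnertonDyer.BirchSwinnertonDyer.Cruxes.GenusPrimitiveSupplyAtTwoPosDiscShallow.GenusSupplyPos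

open Summit.BirchSwinnertonDyer.BirchSwinnertonDyer.Theses.GenusKolyvaginAtTwo
open Summit.BirchSwinnertonDyer.BirchSwinnertonDyer.Theorems

/-! ## §1 The seven stubs — all route items, by name -/

/-- STUB (item 24148, PRINT): Gross–Zagier at all levels. [cite: GrossZagier1986, Thm. I.6.3] -/
theorem stub_grossZagierAllLevels : GrossZagierAllLevels := by
  sorry

/-- STUB (item 19382, PRINT): modularity — a newform of level `N_E`. [cite: BreuilConradDiamondTaylor2001, Thm. A] -/
theorem stub_modularityExistsNewform : ModularityExistsNewform := by
  sorry

/-- STUB (item 23327, PRINT): the 2-parity theorem of Dokchitser–Dokchitser. [cite: DokchitserDokchitser2010, Thm. 1.4] -/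
theorem stub_twoParityDD : TwoParityDD := by
  sorry

/-- STUB (item 19220, declared open 2-converse): `RankOneTwoConverse`. [cite: WZhang2014, Thm. 1.1 (p ≥ 5 only)] -/
theorem stub_rankOneTwoConverse : RankOneTwoConverse := by
  sorry

/-- STUB (item 24948, declared residual complement of the 2-converse off the semistable-at-2 locus). [cite: WZhang2014, Thm. 1.1 (p ≥ 5 only)] -/
theorem stub_rankOneTwoConverseOffSemistableAtTwo : RankOneTwoConverseOffSemistableAtTwo := by
  sorry

/-- STUB (item 31468, LOSSLESS depth-zero kernel K₁⁺, general frame): `K1Pos`. [cite: GrossLMS1991, §5 Prop. 5.3] [cite: Kramer1981, Thm. 1] -/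
theorem stub_K1Pos : K1Pos := by
  sorry

/-- STUB (item 31469, THE beyond-print kernel K₄⁺, prime frame): `K4Pos` — Kolyvagin's conjecture `𝓜_∞ = 0` at `p = 2` on the real-narrow
`#Sel₂(E) = 4` cell with transposition-deep primes (a Frobenius moving a point of `E[2]`). [cite: GrossLMS1991, §11] [cite: WZhang2014, Thm. 1.1 (p ≥ 5 only)] -/
theorem stub_K4Pos : K4Pos := by
  sorry

/-! ## §2 Composition (sorry-free outside the stubs): the LEAD g22 glue-by theorem p766811 -/

/-- COMPOSITION: `GenusPrimitiveSupplyAtTwoPosDiscShallow` BY NAME from the seven item stubs, through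
`GenusSupplyPos.PrimeFrame.genusPrimitiveSupplyAtTwoPosDiscShallow_of_items_of_selmerSplit_mixed` (GZ → Mod → Par → Conv → Conv′ → K1Pos → K4Pos → crux).
BSD is NOT proved by this. [cite: GrossLMS1991, §11] -/
theorem GenusPrimitiveSupplyAtTwoPosDiscShallow_of : GenusPrimitiveSupplyAtTwoPosDiscShallow :=
  GenusSupplyPos.PrimeFrame.genusPrimitiveSupplyAtTwoPosDiscShallow_of_items_of_selmerSplit_mixed stub_grossZagierAllLevels
    stub_modularityExistsNewform stub_twoParityDD stub_rankOneTwoConverse stub_rankOneTwoConverseOffSemistableAtTwo stub_K1Pos stub_K4Pos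

end Summit.BirchSwinnertonDyer.BirchSwinnertonDyer.Cruxes.GenusPrimitiveSupplyAtTwoPosDiscShallow.GenusSupplyPos

end
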